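import Summits.HodgeConjecture.HodgeConjecture.Theorems.P2StubU2OfLetters
import Summits.HodgeConjecture.HodgeConjecture.Theorems.H413ThetaPinBridge
import HarnessLib

/-!
# Crux `H413`, programme P2 — U2′ FROM THE FOUR ENGINE LETTERS, BY NAME (seat F0P2-p03; F0P2-plan (g0) ruling 2026-08-30T22:16:17Z)

HC_CM is proved only modulo the 7 printed citations until rung 0 closes.

The parent stub U2′ `SpectrumInterfaces.StubU2CohFormsSpectrumIsThetaAt` of the P2 line of record («the `(1,0) ⊕ (0,1)` cotangent automorphic spectrum of `U(V)` is theta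
at finite level») from exactly four NAMED Literature letters and nothing else:
* (C) ★ `Rogawski1990.cohFinComponent_isTheta` — the finite component of an `H¹`-cohomological discrete automorphic representation of the inner form `U(H)` is a
  finite-adelic Weil representation `ω(μ, ε_a, χ)_f`, `μ` conjugate symplectic of weight one [Rogawski1990, Thm. 13.3.6 (c), §14.6, §15.3] + [GelbartRogawski1991, 5.1.1 ∕ 5.1.2]
  + [Liu2021, App. D Lem. D.1];
* (C′) `Liu2021.Def411WeilCarriers.rhoAtLine_lineClassTransport` — `ω(μ, ε_a, χ)_f ↪ ω(μ, ε_{a′}, χ)_f` when `a`, `a′` have the same finite local norm classes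
  [Jacobowitz1962, Thm. 3.1; MVW87, Ch. 3 §I; Kudla1994, §1–3];
* (D) ★ `CotangentForms.holCotFormSpectralProjection` ∕ ★ `CotangentForms.antiholCotFormSpectralProjection` — the orthogonal projection onto a discrete `P` of a
  (anti)holomorphic cotangent form is a (anti)holomorphic cotangent form [Borel1997, Thm. 2.13, §8.4; HarishChandra1968; BorelJacquet1979, §4.6].
Composition: ★ `P2StubU2OfLetters.stubU2_of_letters` (detection route: smoothness, `L² = L²_disc` on the compact quotient, J1′, the Hodge split, (D)) with its bridge
hypothesis discharged by ★ `ThetaPinBridge.spectrumIsTheta_of_cohFinComponent hC hC′` (F0P2-p02: (C) at the pin's frame data, the line-class transport (C′), and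
★ `exists_heckeRelated_of_intertwiningMap`).  This is the term the registrar's U2′ fold edition of `Cruxes/H413/Lines/P2ThetaDictionaryExists.lean` ∕ `F0_P2CohSpectrumL2.lean`
reads: `theorem stub_U2_cohFormsSpectrumIsThetaAt := P2StubU2OfLettersFinal.stub_U2_cohFormsSpectrumIsThetaAt_of_letters hC hC′ hD hD′` with sockets (C), (C′), (D), (D̄).

## References
* [Rogawski1990] §12.3 p. 174, Thm. 13.3.6 (c), §14.6, §15.3.  [GelbartRogawski1991] Thm. 5.1.1 p. 465, Lem. 5.1.2 p. 466.  [Liu2021] proof of Prop. 4.13 l. 2131–2146, Rem. 4.14, App. D.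
* [BorelJacquet1979] §4.2–4.6.  [Borel1997] Thm. 2.13, §8.4.  [Jacobowitz1962] Thm. 3.1.
-/

set_option autoImplicit false

-- the mandated namespace has the single-problem summit's repeated segment (`HodgeConjecture.HodgeConjecture`)
set_option linter.dupNamespace false

noncomputable section

namespace Summit.HodgeConjecture.HodgeConjecture.Cruxes.H413.P2StubU2OfLettersFinal

open Literature.NumberTheory.Automorphic.UnitaryGroup.CotangentForms (holCotFormSpectralProjection antiholCotFormSpectralProjection)
open Summit.HodgeConjecture.HodgeConjecture.Cruxes.H413.SpectrumInterfaces (StubU2CohFormsSpectrumIsThetaAt)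

/-- **U2′ FROM THE LETTERS (C), (C′), (D), (D̄) — `StubU2CohFormsSpectrumIsThetaAt` BY NAME.**  At every face of the pin, every irreducible representation of
`U(V)(𝔸_{F⁺,f})` occurring in the `(1,0) ⊕ (0,1)` cotangent automorphic forms of the factor of record is Hecke-related, at some compact open level, to a genuine weight-one
`ω_V(t)` with `ε` global — from the four named engine letters through ★ `P2StubU2OfLetters.stubU2_of_letters` and ★ `ThetaPinBridge.spectrumIsTheta_of_cohFinComponent`.
[cite: Rogawski1990, Thm. 13.3.6 (c); §14.6; §15.3; §12.3 p. 174] [cite: GelbartRogawski1991, Thm 5.1.1 p. 465; Lemma 5.1.2 p. 466] [cite: Liu2021, proof of Prop. 4.13 l. 2131–2146; Rem. 4.14; App. D Lem. D.1]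
[cite: BorelJacquet1979, §4.6] -/
theorem stub_U2_cohFormsSpectrumIsThetaAt_of_letters (hC : Literature.NumberTheory.Rogawski1990.cohFinComponent_isTheta)
    (hC' : Literature.NumberTheory.Automorphic.Liu2021.Def411WeilCarriers.rhoAtLine_lineClassTransport)
    (hD : holCotFormSpectralProjection) (hD' : antiholCotFormSpectralProjection) : StubU2CohFormsSpectrumIsThetaAt :=
  P2StubU2OfLetters.stubU2_of_letters hD hD' (ThetaPinBridge.spectrumIsTheta_of_cohFinComponent hC hC')

end Summit.HodgeConjecture.HodgeConjecture.Cruxes.H413.P2StubU2OfLettersFinal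

end
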